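import Summits.CriticalPhenomena.PercolationContinuityZ3.Theorems.Transplant.FKThreeApexRimStep
import Summits.CriticalPhenomena.PercolationContinuityZ3.Theorems.Transplant.FKThreeApexRigid
import HarnessLib

/-!
# Double fans: two spokes from the SAME apex at ADJACENT rim vertices are negatively correlated (algebra level, every `0 ≤ q ≤ 1`)

Helper file (`--supports stmt-CriticalPhenomena-4575`), FK sub-lane `prim-bschramm-fk-3` (gen 20); builds on p205010 (kernel theorem, internal
audit signed; external expert review pending).  Pure real algebra: no measures, no named facts, no sorries; standard axioms.  Memo
`bschramm/prim-bschramm-fk-3/DOUBLE-FAN.md` §0, §4.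

Setting (`…ThreeApexRimStep`): a double fan is read by the three-apex transfer on the moving boundary `{a = N, b = S, c}` plus the rim step
`E_r = r·id + (1−r)·detach`.  For the pair of `a`-spokes `e = a c_i`, `f = a c_{i+1}` at ADJACENT rim vertices (rim edge `c_i c_{i+1}` of
probability `r`), with `u` the fibre-mass vector of everything up to `c_i` and `s` that of everything from `c_{i+1}` on (read backwards), the
four pinned partition functions are `Z^{αβ} = val_q(s ∗ M(ac)^β · E_r · M(ac)^α u)` (`M(ac)^1 = conv (edgeAC 1)` contracts, `M(ac)^0 = id`
deletes).  **`rayleigh_spokesA_adjacent_eq`**: the Rayleigh difference is EXACTLY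
`Z¹⁰Z⁰¹ − Z¹¹Z⁰⁰ = q²(1−q)·[ F₂·(r² K₁ + r(1−r) F₁) + (1−r)²·N^{(bc)}(u)·N^{(bc)}(s) ]`
with `F₂, K₁, F₁` polynomials with non-negative coefficients in the masses of `u` and `s` (`spokeF2`, `spokeK1`, `spokeF1`; in hat coordinates
`F₂ = vv' − (1−q)yy'`, `K₁ = xx' + zz' − (2−q)uu'`, `F₁ = q(xx'−uu') + q²uu' + q(uc'+cu') + 2cc'`).  The structural reason (memo §4): the
polarisation `D h₁ ∧ h₀ + h₁ ∧ D h₀` of an `a`-spoke frame is RANK ONE on the `ac`-bipartite index pairs.  Hence (**`rayleigh_spokesA_adjacent_nonneg`**)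
the difference is `≥ 0` whenever `u, s` have non-negative masses and `N^{(bc)}(u), N^{(bc)}(s) ≥ 0` — in particular for all `u, s ∈ InKE q`
(**`InKE.rayleigh_spokesA_adjacent_nonneg`**), and symmetrically for two `b`-spokes (**`rayleigh_spokesB_adjacent_nonneg`**).  Also recorded: `detach`
is idempotent up to `q` (`detach_detach`), `E_r ∘ detach = (r + (1−r)q)·detach` (`rimStep_detach`), `val ∘ detach = q·val` (`val_detach`).
NOT here: the pair (`a c_i`, `b c_{i+1}`) of spokes to DIFFERENT apices (generalised T5, memo §5) and the measure-level bridge for double fans.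
[cite: Grimmett2006, §3.9 eq. (3.94) (pp. 63–64)] [cite: Wagner2006, Conj. 5.3 (p. 13)] [folklore]
-/

noncomputable section

namespace Summit.CriticalPhenomena.PercolationContinuityZ3.Theorems

namespace FK

namespace ThreeApex

/-! ### `detach` and `val` -/

/-- Detaching twice is detaching once with one more isolated vertex: `detach (detach Z) = q • detach Z`. [folklore] -/
theorem detach_detach (q : ℝ) (Z : V5) : detach q (detach q Z) = V5.smul q (detach q Z) := by
  ext <;> simp only [detach, V5.smul] <;> ring

/-- A rim step after a detach only rescales: `E_r (detach Z) = (r + (1−r) q) • detach Z`. [folklore] -/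
theorem rimStep_detach (q r : ℝ) (Z : V5) : rimStep q r (detach q Z) = V5.smul (r + (1 - r) * q) (detach q Z) := by
  ext <;> simp only [rimStep, detach, V5.smul] <;> ring

/-- The free valuation of the detached vector: `val (detach Z) = q · val Z` (the fresh `c` is an isolated vertex). [folklore] -/
theorem val_detach (q : ℝ) (Z : V5) : val q (detach q Z) = q * val q Z := by
  simp only [val, detach]; ring

/-- The free valuation after a rim step: `val (E_r Z) = (r + (1−r) q) · val Z`. [folklore] -/
theorem val_rimStep (q r : ℝ) (Z : V5) : val q (rimStep q r Z) = (r + (1 - r) * q) * val q Z := by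
  simp only [val, rimStep]; ring

/-- `val` is invariant under `a ↔ b`. [folklore] -/
theorem val_swapAB (q : ℝ) (Z : V5) : val q (swapAB Z) = val q Z := by
  simp only [val, swapAB]; ring

/-- Deleting a boundary edge is the identity: `conv (edgeAC 0) Z = Z`. [folklore] -/
theorem conv_edgeAC_zero (Z : V5) : conv (edgeAC 0) Z = Z := by
  ext <;> simp [conv, edgeAC, V5.total]

/-! ### The three non-negative factors -/

/-- `F₂(u,s) = v v' − (1−q) y y'` in hat coordinates; in masses a polynomial with non-negative coefficients. [folklore] -/
def spokeF2 (q : ℝ) (u s : V5) : ℝ :=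
  q * u.zac * s.zac + q * u.zac * s.z0 + q * u.z0 * s.zac + q * u.z0 * s.z0 + u.z1 * s.z1 + u.z1 * s.zbc + u.z1 * s.zac + u.z1 * s.zab
    + u.z1 * s.z0 + u.zbc * s.z1 + u.zbc * s.zbc + u.zbc * s.zac + u.zbc * s.zab + u.zbc * s.z0 + u.zac * s.z1 + u.zac * s.zbc + u.zac * s.zab
    + u.zab * s.z1 + u.zab * s.zbc + u.zab * s.zac + u.zab * s.zab + u.zab * s.z0 + u.z0 * s.z1 + u.z0 * s.zbc + u.z0 * s.zab

/-- `K₁(u,s) = x x' + z z' − (2−q) u u'` in hat coordinates (the parallel-edge factor). [folklore] -/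
def spokeK1 (q : ℝ) (u s : V5) : ℝ :=
  q * u.z0 * s.z0 + u.zbc * s.zbc + u.zbc * s.z0 + u.zab * s.zab + u.zab * s.z0 + u.z0 * s.zbc + u.z0 * s.zab

/-- `F₁(u,s) = q(xx' − uu') + q² uu' + q(u c' + c u') + 2 c c'` (`c = z − u = Z_bc`) in hat coordinates. [folklore] -/
def spokeF1 (q : ℝ) (u s : V5) : ℝ :=
  q ^ 2 * u.z0 * s.z0 + q * u.zbc * s.z0 + q * u.zab * s.zab + q * u.zab * s.z0 + q * u.z0 * s.zbc + q * u.z0 * s.zab + 2 * u.zbc * s.zbc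

/-- `F₂ ≥ 0` for non-negative masses and `q ≥ 0`. [folklore] -/
theorem spokeF2_nonneg {q : ℝ} (hq0 : 0 ≤ q) {u s : V5} (hu : u.Nonneg) (hs : s.Nonneg) : 0 ≤ spokeF2 q u s := by
  obtain ⟨h0, h1, h2, h3, h4⟩ := hu; obtain ⟨g0, g1, g2, g3, g4⟩ := hs
  unfold spokeF2; positivity

/-- `K₁ ≥ 0` for non-negative masses and `q ≥ 0`. [folklore] -/
theorem spokeK1_nonneg {q : ℝ} (hq0 : 0 ≤ q) {u s : V5} (hu : u.Nonneg) (hs : s.Nonneg) : 0 ≤ spokeK1 q u s := by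
  obtain ⟨h0, h1, h2, h3, h4⟩ := hu; obtain ⟨g0, g1, g2, g3, g4⟩ := hs
  unfold spokeK1; positivity

/-- `F₁ ≥ 0` for non-negative masses and `q ≥ 0`. [folklore] -/
theorem spokeF1_nonneg {q : ℝ} (hq0 : 0 ≤ q) {u s : V5} (hu : u.Nonneg) (hs : s.Nonneg) : 0 ≤ spokeF1 q u s := by
  obtain ⟨h0, h1, h2, h3, h4⟩ := hu; obtain ⟨g0, g1, g2, g3, g4⟩ := hs
  unfold spokeF1; positivity

/-! ### The exact Rayleigh difference of two `a`-spokes at adjacent rim vertices -/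

/-- The pinned partition function `Z^{αβ} = val_q(s ∗ M(ac)^β E_r M(ac)^α u)` of the configuration "`a`-spoke (state `α`) at the rim vertex
carrying `u`, rim edge of probability `r`, `a`-spoke (state `β`) at the next rim vertex carrying `s`". [folklore] -/
def spokesAZ (q r : ℝ) (u s : V5) (α β : ℝ) : ℝ :=
  val q (conv s (conv (edgeAC β) (rimStep q r (conv (edgeAC α) u))))

/-- **Exact formula.** `Z¹⁰Z⁰¹ − Z¹¹Z⁰⁰ = q²(1−q)[F₂(r²K₁ + r(1−r)F₁) + (1−r)² N^{(bc)}(u) N^{(bc)}(s)]`. [folklore] -/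
theorem rayleigh_spokesA_adjacent_eq (q r : ℝ) (u s : V5) :
    spokesAZ q r u s 1 0 * spokesAZ q r u s 0 1 - spokesAZ q r u s 1 1 * spokesAZ q r u s 0 0 =
      q ^ 2 * (1 - q) * (spokeF2 q u s * (r ^ 2 * spokeK1 q u s + r * (1 - r) * spokeF1 q u s)
        + (1 - r) ^ 2 * (masterN q (swapAB u) * masterN q (swapAB s))) := by
  simp only [spokesAZ, val, conv, edgeAC, rimStep, V5.total, spokeF2, spokeK1, spokeF1, masterN, swapAB]
  ring

/-- **Two `a`-spokes at adjacent rim vertices are negatively correlated** (algebra level): the Rayleigh difference is `≥ 0` whenever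
`0 ≤ q ≤ 1`, `0 ≤ r ≤ 1`, the masses of `u, s` are `≥ 0` and `N^{(bc)}(u), N^{(bc)}(s) ≥ 0`. [folklore] -/
theorem rayleigh_spokesA_adjacent_nonneg {q r : ℝ} (hq0 : 0 ≤ q) (hq1 : q ≤ 1) (hr0 : 0 ≤ r) (hr1 : r ≤ 1) {u s : V5} (hu : u.Nonneg)
    (hs : s.Nonneg) (hU : 0 ≤ masterN q (swapAB u)) (hS : 0 ≤ masterN q (swapAB s)) :
    0 ≤ spokesAZ q r u s 1 0 * spokesAZ q r u s 0 1 - spokesAZ q r u s 1 1 * spokesAZ q r u s 0 0 := by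
  have hq' : 0 ≤ 1 - q := sub_nonneg.2 hq1
  have hr' : 0 ≤ 1 - r := sub_nonneg.2 hr1
  have h2 := spokeF2_nonneg hq0 hu hs
  have h1 := spokeK1_nonneg hq0 hu hs
  have h3 := spokeF1_nonneg hq0 hu hs
  rw [rayleigh_spokesA_adjacent_eq]
  positivity

/-- The same for rests in the rim-step closure `InKE q` of the three-apex monoid (prefix and reversed suffix of a double fan with leaves). [folklore] -/
theorem InKE.rayleigh_spokesA_adjacent_nonneg {q r : ℝ} (hq0 : 0 ≤ q) (hq1 : q ≤ 1) (hr0 : 0 ≤ r) (hr1 : r ≤ 1) {u s : V5} (hu : InKE q u)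
    (hs : InKE q s) : 0 ≤ spokesAZ q r u s 1 0 * spokesAZ q r u s 0 1 - spokesAZ q r u s 1 1 * spokesAZ q r u s 0 0 :=
  ThreeApex.rayleigh_spokesA_adjacent_nonneg hq0 hq1 hr0 hr1 (hu.valid hq0 hq1).nonneg (hs.valid hq0 hq1).nonneg (hu.valid hq0 hq1).nBC
    (hs.valid hq0 hq1).nBC

/-! ### Two `b`-spokes (the other apex), by the `a ↔ b` symmetry -/

/-- The pinned partition function for two `b`-spokes at adjacent rim vertices. [folklore] -/
def spokesBZ (q r : ℝ) (u s : V5) (α β : ℝ) : ℝ :=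
  val q (conv s (conv (edgeBC β) (rimStep q r (conv (edgeBC α) u))))

/-- `a ↔ b` turns `b`-spokes into `a`-spokes: `Z_B^{αβ}(u,s) = Z_A^{αβ}(swapAB u, swapAB s)`. [folklore] -/
theorem spokesBZ_eq_spokesAZ_swapAB (q r : ℝ) (u s : V5) (α β : ℝ) :
    spokesBZ q r u s α β = spokesAZ q r (swapAB u) (swapAB s) α β := by
  simp only [spokesBZ, spokesAZ, val, conv, edgeAC, edgeBC, rimStep, swapAB, V5.total]
  ring

/-- **Two `b`-spokes at adjacent rim vertices are negatively correlated** (algebra level), for rests in `InKE q`. [folklore] -/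
theorem InKE.rayleigh_spokesB_adjacent_nonneg {q r : ℝ} (hq0 : 0 ≤ q) (hq1 : q ≤ 1) (hr0 : 0 ≤ r) (hr1 : r ≤ 1) {u s : V5} (hu : InKE q u)
    (hs : InKE q s) : 0 ≤ spokesBZ q r u s 1 0 * spokesBZ q r u s 0 1 - spokesBZ q r u s 1 1 * spokesBZ q r u s 0 0 := by
  simp only [spokesBZ_eq_spokesAZ_swapAB]
  exact InKE.rayleigh_spokesA_adjacent_nonneg hq0 hq1 hr0 hr1 hu.swapAB hs.swapAB

end ThreeApex

end FK

end Summit.CriticalPhenomena.PercolationContinuityZ3.Theorems
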